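import Mathlib
import Summits.Ventures.PercRepro.TriangleCapRowACap

/-!
# PercRepro — THE CAP ON THE CELL `(k, a, a)` FOR EVERY ROW `a ≥ 5`, ASSEMBLED: a `K₄⁻`-free graph with `a (k − a) − a`
edges on `k ≥ 3a` vertices and a vertex of degree `k − a` is `a`-bipartite or at least `2 (k − a − 3)` below the
closed form (p3, gen 47; part 200n)

The skeleton of part 200g with the pieces of part 200m: `E = 0` (`rowA_noedge`, every `K ≥ 2a`), `M ≤ 1`
(`rowA_matching`), `M = 0` is `D ⊆ K(N(x)ᶜ, N(x))`, `M = 1` is the one-triangle structure with deficit `2`: the `R`-sum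
`rowA_R_sum`, the refined `N`-sum `rowA_N_sum` (the exact vertex identity and the loss on the non-ends), and
`rowA_sq_arith`. Axioms: standard.
-/

namespace PercRepro

namespace TriangleCap

namespace C047

open Finset

variable {V : Type*} [Fintype V] [DecidableEq V]

omit [DecidableEq V] in
/-- **THE REFINED `N`-SUM AT `M = 1`, `r = a`** (`a = a' + 5`, `|R| = a − 1`): with `d(y) = 1 + f(y) + g(y)`, `f ≤ 1`,
`Σ_N f = 2`, `Σ_N g = P`, `2 Σ_N fg ≤ 2 (a − 1)`, `P + a + 1 + K = aK`, `|N| = K`, `|R| = a − 1`: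
`Σ_N d² + 2 (a − 1)(K − 2) ≤ K + 6 + (a + 3) P`. -/
theorem rowA_N_sum (D : SimpleGraph V) [DecidableRel D.Adj] (N R : Finset V) (K a' P : ℕ)
    (hKdef : N.card = K) (hRcard : R.card = a' + 4)
    (hdegN : ∀ y ∈ N, deg D y = 1 + degIn D N y + degIn D R y) (hf1 : ∀ y ∈ N, degIn D N y ≤ 1)
    (hTf : ∑ y ∈ N, degIn D N y = 2) (hPdef : ∑ y ∈ N, degIn D R y = P)
    (hfg_le : 2 * ∑ y ∈ N, degIn D N y * degIn D R y ≤ 2 * (a' + 4))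
    (hP : P + (a' + 5) + 1 + K = (a' + 5) * K) :
    ∑ y ∈ N, deg D y * deg D y + 2 * (a' + 5 - 1) * (K - 2) ≤ K + 6 + (a' + 5 + 3) * P := by
  have hg : ∀ y ∈ N, degIn D R y + 1 ≤ a' + 5 := fun y _ => by
    have := degIn_le_card D R y
    omega
  -- the exact identity summed over `N`
  have hid : ∀ y ∈ N, deg D y * deg D y + degIn D R y * (a' + 5 - 1 - degIn D R y) =
      1 + 3 * degIn D N y + (a' + 5 + 1) * degIn D R y + 2 * (degIn D N y * degIn D R y) := fun y hy => by
    rw [hdegN y hy]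
    exact rowA_vertex_identity _ _ _ (hf1 y hy) (hg y hy)
  have hsumid : ∑ y ∈ N, deg D y * deg D y + ∑ y ∈ N, degIn D R y * (a' + 5 - 1 - degIn D R y) =
      K + 3 * 2 + (a' + 5 + 1) * P + 2 * ∑ y ∈ N, degIn D N y * degIn D R y := by
    rw [← sum_add_distrib, sum_congr rfl hid, sum_add_distrib, sum_add_distrib, sum_add_distrib, sum_const,
      smul_eq_mul, mul_one, ← mul_sum, ← mul_sum, ← mul_sum, hKdef, hTf, hPdef]
  -- the non-ends `S₀` and the ends `S₁`
  obtain ⟨S₀, hS₀⟩ : ∃ S₀ : Finset V, S₀ = N.filter (fun y => degIn D N y = 0) := ⟨_, rfl⟩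
  obtain ⟨S₁, hS₁⟩ : ∃ S₁ : Finset V, S₁ = N.filter (fun y => ¬ degIn D N y = 0) := ⟨_, rfl⟩
  have hS₁card : S₁.card = 2 := by
    have h : ∑ y ∈ N, degIn D N y = ∑ y ∈ S₁, 1 := by
      rw [hS₁, sum_filter]
      apply sum_congr rfl
      intro y hy
      have := hf1 y hy
      split_ifs with h <;> omega
    rw [hTf, sum_const, smul_eq_mul, mul_one] at h
    exact h.symm
  have hS₀card : S₀.card + 2 = K := by
    have := card_filter_add_card_filter_not (s := N) (fun y => degIn D N y = 0)
    rw [← hS₀, ← hS₁, hS₁card, hKdef] at this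
    exact this
  have hfg : ∑ y ∈ N, degIn D N y * degIn D R y = ∑ y ∈ S₁, degIn D R y := by
    rw [hS₁, sum_filter]
    apply sum_congr rfl
    intro y hy
    have := hf1 y hy
    by_cases h : degIn D N y = 0
    · rw [if_neg (fun h' => h' h), h, zero_mul]
    · have h1 : degIn D N y = 1 := by omega
      rw [h1, if_pos (by omega), one_mul]
  have hgsplit : ∑ y ∈ N, degIn D R y = ∑ y ∈ S₀, degIn D R y + ∑ y ∈ S₁, degIn D R y := by
    rw [hS₀, hS₁, sum_filter_add_sum_filter_not]
  -- `Σ_{S₀} (a − 1 − g) + Σ_{S₀} g = |S₀| (a − 1)`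
  have hmiss : ∑ y ∈ S₀, (a' + 5 - 1 - degIn D R y) + ∑ y ∈ S₀, degIn D R y = S₀.card * (a' + 4) := by
    rw [← sum_add_distrib]
    have h : ∀ y ∈ S₀, (a' + 5 - 1 - degIn D R y) + degIn D R y = a' + 4 := fun y hy => by
      have := hg y (mem_of_mem_filter y (hS₀ ▸ hy))
      omega
    rw [sum_congr rfl h, sum_const, smul_eq_mul]
  -- `Σ_{S₀} (a − 1 − g) ≤ 2`
  have hmiss2 : ∑ y ∈ S₀, (a' + 5 - 1 - degIn D R y) ≤ 2 := by
    obtain ⟨K', hK'⟩ : ∃ K', K = K' + 2 := ⟨K - 2, by omega⟩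
    have hS₀' : S₀.card = K' := by omega
    rw [hS₀'] at hmiss
    rw [hK'] at hP
    rw [hfg] at hfg_le
    rw [hgsplit] at hPdef
    nlinarith [hmiss, hP, hfg_le, hPdef]
  -- the loss on the non-ends
  have hloss : ∑ y ∈ S₀, 2 * (a' + 5 - 1 - degIn D R y) ≤
      ∑ y ∈ S₀, degIn D R y * (a' + 5 - 1 - degIn D R y) := by
    apply sum_le_sum
    intro y hy
    have hyN : y ∈ N := mem_of_mem_filter y (hS₀ ▸ hy)
    have hle : a' + 5 - 1 - degIn D R y ≤ 2 :=
      le_trans (single_le_sum (f := fun y => a' + 5 - 1 - degIn D R y) (fun _ _ => Nat.zero_le _) hy) hmiss2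
    exact rowA_loss_vertex _ _ (by omega) (hg y hyN) hle
  have hloss2 : ∑ y ∈ S₀, degIn D R y * (a' + 5 - 1 - degIn D R y) ≤
      ∑ y ∈ N, degIn D R y * (a' + 5 - 1 - degIn D R y) := by
    rw [hS₀]
    exact sum_le_sum_of_subset (filter_subset _ _)
  rw [← mul_sum] at hloss
  -- assemble
  have e1 : 2 * (a' + 5 - 1) * (K - 2) = 2 * (S₀.card * (a' + 4)) := by
    have : K - 2 = S₀.card := by omega
    have e0 : a' + 5 - 1 = a' + 4 := by omega
    rw [this, e0]
    ring
  rw [e1]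
  rw [hfg] at hsumid
  rw [hgsplit] at hPdef
  have e2 : (a' + 5 + 3) * P = (a' + 5 + 1) * P + 2 * P := by ring
  rw [e2]
  omega

/-- **THE CAP ON THE CELL `(k, a, a)`, `a ≥ 5`, `k ≥ 3a`:** a `K₄⁻`-free graph with `a (k − a) − a` edges and a
vertex `x` of degree `k − a` is a spanning subgraph of some `K(A, Aᶜ)` with `|A| = a`, or
`Σ_v d(v)² + a (k − 1 − a) + 2 (k − a − 3) ≤ m k`. -/
theorem cap_A_gen (D : SimpleGraph V) [DecidableRel D.Adj] (hK : K4mFree D) (a : ℕ) (ha5 : 5 ≤ a)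
    (hk : 3 * a ≤ Fintype.card V) (hm : D.edgeFinset.card + a = a * (Fintype.card V - a)) (x : V)
    (hx : deg D x + a = Fintype.card V) :
    (∃ A : Finset V, A.card = a ∧ BipSub D A) ∨
      ∑ v, deg D v * deg D v + a * (Fintype.card V - 1 - a) + 2 * (Fintype.card V - a - 3) ≤
        D.edgeFinset.card * Fintype.card V := by
  obtain ⟨N, hN⟩ : ∃ N : Finset V, N = univ.filter (fun w => D.Adj x w) := ⟨_, rfl⟩
  have hmemN : ∀ w, w ∈ N ↔ D.Adj x w := fun w => by rw [hN, mem_filter]; simp only [mem_univ, true_and]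
  have hxN : x ∉ N := fun h => D.irrefl ((hmemN x).mp h)
  have hdx : deg D x = N.card := by rw [hN]; rfl
  obtain ⟨K, hKdef⟩ : ∃ K, N.card = K := ⟨_, rfl⟩
  have hcardV : Fintype.card V = K + a := by omega
  obtain ⟨m, hmdef⟩ : ∃ m, D.edgeFinset.card = m := ⟨_, rfl⟩
  have hcap : ∀ v, deg D v + a ≤ Fintype.card V := fun v =>
    deg_add_le_card_of_dense D hK a (by omega) (by omega)
      (cap_arith a (Fintype.card V) D.edgeFinset.card a (by omega) (by omega)
        (below_cap_arith a (Fintype.card V) D.edgeFinset.card a (by omega) hm)) v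
  rw [hmdef, hcardV, Nat.add_sub_cancel] at hm
  obtain ⟨R, hR⟩ : ∃ R : Finset V, R = (insert x N)ᶜ := ⟨_, rfl⟩
  have hRcard : R.card + 1 = a := by
    rw [hR, card_compl, card_insert_of_notMem hxN]
    omega
  have hmemR : ∀ w, w ∈ R ↔ w ≠ x ∧ ¬ D.Adj x w := by
    intro w
    rw [hR, mem_compl, mem_insert, hmemN]
    tauto
  obtain ⟨M, hM⟩ : ∃ M, adjPairs D N = 2 * M := ⟨_, adjPairs_eq_two_mul D N⟩
  have hTf : ∑ y ∈ N, degIn D N y = 2 * M := by rw [← adjPairs_eq_sum_degIn, hM]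
  obtain ⟨P, hPdef⟩ : ∃ P, ∑ u ∈ R, degIn D N u = P := ⟨_, rfl⟩
  obtain ⟨E, hEdef⟩ : ∃ E, adjPairs D R = E := ⟨_, rfl⟩
  have hsplit : ∀ F : V → ℕ, ∑ w, F w = F x + ∑ y ∈ N, F y + ∑ u ∈ R, F u := by
    intro F
    rw [← sum_add_sum_compl (insert x N), sum_insert hxN, ← hR]
  have hdegN : ∀ y ∈ N, deg D y = 1 + degIn D N y + degIn D R y := by
    intro y hy
    have := deg_eq_of_mem_nbhd D x y ((hmemN y).mp hy)
    rw [← hN, ← hR] at this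
    exact this
  have hsumN : ∑ y ∈ N, deg D y = K + 2 * M + P := by
    rw [sum_congr rfl hdegN, sum_add_distrib, sum_add_distrib, sum_const, smul_eq_mul, mul_one, hKdef, hTf,
      sum_degIn_comm D N R, hPdef]
  have hdegR : ∀ u ∈ R, deg D u = degIn D N u + degIn D R u := by
    intro u hu
    have := deg_eq_of_not_mem_nbhd D x u ((hmemR u).mp hu).2
    rw [← hN, ← hR] at this
    exact this
  have hsumR : ∑ u ∈ R, deg D u = P + E := by
    rw [sum_congr rfl hdegR, sum_add_distrib, hPdef, ← adjPairs_eq_sum_degIn, hEdef]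
  have hdegsum := sum_deg_eq D
  rw [hsplit, hsumN, hsumR, hdx, hKdef, hmdef] at hdegsum
  have hcapK : ∀ u ∈ R, deg D u ≤ K := fun u _ => by have := hcap u; omega
  have h1 : P + E ≤ (a - 1) * K := by
    rw [← hsumR]
    calc ∑ u ∈ R, deg D u ≤ ∑ _u ∈ R, K := sum_le_sum (fun u hu => hcapK u hu)
      _ = (a - 1) * K := by rw [sum_const, smul_eq_mul]; congr 1; omega
  have hPle : ∀ u ∈ R, degIn D N u + M ≤ K := by
    intro u hu
    have := two_mul_degIn_add_adjPairs_le D hK (x := x) ((hmemR u).mp hu).1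
    rw [← hN, hM, hKdef] at this
    omega
  have h2 : P + (a - 1) * M ≤ (a - 1) * K := by
    have hs : ∑ u ∈ R, (degIn D N u + M) ≤ ∑ _u ∈ R, K := sum_le_sum hPle
    rw [sum_add_distrib, sum_const, sum_const, smul_eq_mul, smul_eq_mul, hPdef] at hs
    have e : R.card = a - 1 := by omega
    rw [e] at hs
    exact hs
  obtain ⟨a', rfl⟩ : ∃ a', a = a' + 5 := ⟨a - 5, by omega⟩
  have e1 : a' + 5 - 1 = a' + 4 := by omega
  rw [e1] at h1 h2
  -- no edge inside `R`
  have hE0 : E = 0 := by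
    by_contra hE
    obtain ⟨u, hu, hu1⟩ : ∃ u ∈ R, 1 ≤ degIn D R u := by
      by_contra hcon
      push Not at hcon
      have h0 : ∑ u ∈ R, degIn D R u = 0 := sum_eq_zero (fun u hu => by have := hcon u hu; omega)
      rw [← adjPairs_eq_sum_degIn, hEdef] at h0
      exact hE h0
    obtain ⟨v, hv, huv⟩ : ∃ v ∈ R, D.Adj u v := by
      unfold degIn at hu1
      obtain ⟨v, hv⟩ := card_pos.mp hu1
      rw [mem_filter] at hv
      exact ⟨v, hv.1, hv.2⟩
    have hne : u ≠ v := D.ne_of_adj huv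
    have hPuv : degIn D N u + degIn D N v ≤ K + 1 := by
      have := degIn_add_degIn_le_of_adj_pair D hK N huv
      rw [hKdef] at this
      exact this
    have hvR' : v ∈ R.erase u := mem_erase.mpr ⟨hne.symm, hv⟩
    have hsum1 := add_sum_erase R (fun w => degIn D N w) hu
    have hsum2 := add_sum_erase (R.erase u) (fun w => degIn D N w) hvR'
    have hsum1' := add_sum_erase R (fun w => degIn D R w) hu
    have hsum2' := add_sum_erase (R.erase u) (fun w => degIn D R w) hvR'
    have hcard2 : ((R.erase u).erase v).card = a' + 2 := by
      rw [card_erase_of_mem hvR', card_erase_of_mem hu]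
      omega
    have hrest : ∑ w ∈ (R.erase u).erase v, degIn D N w + (a' + 2) * M ≤ (a' + 2) * K := by
      have hs : ∑ w ∈ (R.erase u).erase v, (degIn D N w + M) ≤ ∑ _w ∈ (R.erase u).erase v, K :=
        sum_le_sum (fun w hw => hPle w (mem_of_mem_erase (mem_of_mem_erase hw)))
      rw [sum_add_distrib, sum_const, sum_const, smul_eq_mul, smul_eq_mul, hcard2] at hs
      exact hs
    have hr : ∑ w ∈ (R.erase u).erase v, degIn D N w + ∑ w ∈ (R.erase u).erase v, degIn D R w ≤ (a' + 2) * K := by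
      rw [← sum_add_distrib]
      calc ∑ w ∈ (R.erase u).erase v, (degIn D N w + degIn D R w)
          = ∑ w ∈ (R.erase u).erase v, deg D w :=
            sum_congr rfl (fun w hw => (hdegR w (mem_of_mem_erase (mem_of_mem_erase hw))).symm)
        _ ≤ ∑ _w ∈ (R.erase u).erase v, K :=
            sum_le_sum (fun w hw => hcapK w (mem_of_mem_erase (mem_of_mem_erase hw)))
        _ = (a' + 2) * K := by rw [sum_const, smul_eq_mul, hcard2]
    have hu' : degIn D N u + degIn D R u ≤ K := by rw [← hdegR u hu]; exact hcapK u hu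
    have hv' : degIn D N v + degIn D R v ≤ K := by rw [← hdegR v hv]; exact hcapK v hv
    have hdu : degIn D R u ≤ a' + 3 := by
      have := degIn_le_card_erase D R u
      rw [card_erase_of_mem hu] at this
      omega
    have hdv : degIn D R v ≤ a' + 3 := by
      have := degIn_le_card_erase D R v
      rw [card_erase_of_mem hv] at this
      omega
    have hEsum : E = degIn D R u + (degIn D R v + ∑ w ∈ (R.erase u).erase v, degIn D R w) := by
      rw [← hEdef, adjPairs_eq_sum_degIn, ← hsum1', ← hsum2']
    have hPsum : P = degIn D N u + (degIn D N v + ∑ w ∈ (R.erase u).erase v, degIn D N w) := by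
      rw [← hPdef, ← hsum1, ← hsum2]
    exact rowA_noedge a' K M P E m _ _ _ _ _ _ (by omega) hdegsum hm h1 hPuv hrest (by rw [hPsum]; ring)
      (by rw [hEsum]; ring) hu' hv' hr hdu hdv
  have hM1' : M ≤ 1 := rowA_matching (a' + 5) K M P m (by omega) (by rw [hE0] at hdegsum; exact hdegsum) hm
    (by rw [e1]; exact h2)
  have hnoR : ∀ u ∈ R, degIn D R u = 0 := by
    intro u hu
    have hle : degIn D R u ≤ ∑ z ∈ R, degIn D R z := single_le_sum (fun _ _ => Nat.zero_le _) hu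
    rw [← adjPairs_eq_sum_degIn, hEdef, hE0] at hle
    exact Nat.le_zero.mp hle
  rcases Nat.eq_zero_or_pos M with hM0 | hMpos
  · left
    have hnoN : ∀ y ∈ N, ∀ y', D.Adj y y' → y' ∉ N := by
      intro y hy y' hyy' hy'
      have h0 : degIn D N y = 0 := by
        have hle : degIn D N y ≤ ∑ z ∈ N, degIn D N z := single_le_sum (fun _ _ => Nat.zero_le _) hy
        rw [hTf, hM0, mul_zero] at hle
        exact Nat.le_zero.mp hle
      unfold degIn at h0
      rw [card_eq_zero, filter_eq_empty_iff] at h0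
      exact h0 hy' hyy'
    have hnoR' : ∀ u ∈ R, ∀ u', D.Adj u u' → u' ∉ R := by
      intro u hu u' huu' hu'
      have h0 := hnoR u hu
      unfold degIn at h0
      rw [card_eq_zero, filter_eq_empty_iff] at h0
      exact h0 hu' huu'
    refine ⟨Nᶜ, ?_, ?_⟩
    · rw [card_compl, hKdef]
      omega
    · intro p q hpq
      rw [mem_compl, mem_compl, not_not]
      constructor
      · intro hpN
        by_contra hqN
        by_cases hpx : p = x
        · subst hpx
          exact hqN ((hmemN q).mpr hpq)
        by_cases hqx : q = x
        · subst hqx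
          exact hpN ((hmemN p).mpr (D.adj_symm hpq))
        have hpR : p ∈ R := (hmemR p).mpr ⟨hpx, fun h => hpN ((hmemN p).mpr h)⟩
        have hqR : q ∈ R := (hmemR q).mpr ⟨hqx, fun h => hqN ((hmemN q).mpr h)⟩
        exact hnoR' p hpR q hpq hqR
      · intro hqN hpN
        exact hnoN p hpN q hpq hqN
  · right
    have hM1'' : M = 1 := by omega
    subst hM1''
    have hP : P + (a' + 5) + 1 + K = (a' + 5) * K := by omega
    have hPle' : ∀ u ∈ R, degIn D N u + 1 ≤ K := hPle
    have hsumR' : ∑ u ∈ R, degIn D N u + 2 = R.card * (K - 1) := by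
      rw [hPdef]
      have e : R.card = a' + 4 := by omega
      rw [e]
      obtain ⟨K', rfl⟩ : ∃ K', K = K' + 1 := ⟨K - 1, by omega⟩
      rw [Nat.add_sub_cancel]
      nlinarith [hP]
    have hSR := rowA_R_sum D R N K (by omega) hPle' hsumR'
    have hdegRu : ∀ t ∈ R, deg D t = degIn D N t := fun t ht => by
      rw [hdegR t ht, hnoR t ht, add_zero]
    have hSR' : ∑ u ∈ R, deg D u * deg D u + (2 * K - 4) * 2 ≤ (a' + 5 - 1) * ((K - 1) * (K - 1)) := by
      rw [sum_congr rfl (fun t ht => by rw [hdegRu t ht])]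
      have e : R.card = a' + 5 - 1 := by omega
      rw [← e]
      exact hSR
    have hfg_le : 2 * ∑ y ∈ N, degIn D N y * degIn D R y ≤ 2 * (a' + 4) := by
      have := two_mul_sum_degIn_mul_degIn_le D hK x R (fun u hu => ((hmemR u).mp hu).1)
      rw [← hN, hM] at this
      have e : R.card = a' + 4 := by omega
      rw [e] at this
      omega
    have hf1 : ∀ y ∈ N, degIn D N y ≤ 1 := fun y hy => by
      have h1 := degIn_nbhd_le_one D hK (x := x) (u := y) ((hmemN y).mp hy)
      rw [← hN] at h1
      exact h1
    have hSN := rowA_N_sum D N R K a' P hKdef (by omega) hdegN hf1 (by rw [hTf])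
      (by rw [sum_degIn_comm D N R]; exact hPdef) hfg_le hP
    rw [hsplit (fun v => deg D v * deg D v), hdx, hKdef, hmdef, hcardV]
    exact rowA_sq_arith (a' + 5) K P _ _ m ha5 (by omega) hm hP hSN hSR'

end C047

end TriangleCap

end PercRepro
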